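import Summits.NavierStokesRegularity.NavierStokesRegularity.Theorems.PerpetualPumpThesisBesovDuhamelBoundParseval
import Literature.Analysis.FluidPDE.TaoAveragedSlotSobolev

/-!
# Stub `besovDuhamelBound` for `PerpetualPump.Thesis`, part VI: the divergence-free test fields
# `w_{k,x,i} = P Δ̇_k δ_x e_i` and the blocks of a divergence-free field as pairings

Support file (part 6 of the stub `besovDuhamelBound` of line `SketchIdeator2`, crux
stmt-NavierStokesRegularity-1832). Tao's mild formulation ((1.15), J. Amer. Math. Soc. 29 (2016))
only gives access to a solution `u(t) ∈ H¹⁰_df` through its pairings `⟨u(t), w⟩` with **real,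
divergence-free** test fields `w ∈ H¹⁰_df`. To estimate the dyadic blocks `Δ̇_k u(t)` in `L^∞` we
use, for each frequency `k ∈ ℤ`, point `x ∈ ℝ³` and coordinate `i`, the field `w_{k,x,i} ∈ L²(ℝ³; ℂ³)`
with Fourier transform

  `ŵ_{k,x,i}(η) = e^{-2πi x·η} φ_k(η) P(η) e_i`,  `P(η) v = v - (η·v/|η|²) η` (Leray symbol),

(`FA.exists_testField`): it is real (Hermitian transform), divergence free (`η · P(η)e_i = 0`),
band-limited hence in `H¹⁰_df`, and for every divergence-free `f ∈ L²`

  `⟨f, w_{k,x,i}⟩ = ∫ e^{2πi x·ξ} φ_k(ξ) f̂_i(ξ) dξ = (Δ̇_k f)_i(x)`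

(Parseval for the bilinear pairing, `P(ξ)f̂(ξ) = f̂(ξ)`). Consequently
(`FA.eLpNormDistrib_lpBlock_coe_le_of_pairing`) a uniform bound `|⟨f, w_{k,x,i}⟩| ≤ B` over `x, i`
gives `‖Δ̇_k f‖_{L^∞} ≤ 3B` — the bridge from Tao's duality formulation to the Besov norm
`‖f‖_{Ḃ⁰_{∞,1}} = ∑_k ‖Δ̇_k f‖_{L^∞}`. Also recorded: the algebra of the Leray symbol
(`η · P(η)v = 0`, `P(η)v · f = f·v` minus the divergence part, reality, evenness, homogeneity).

## References

* T. Tao, J. Amer. Math. Soc. 29 (2016), 601–674, §1.1 (1.15).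
* H. Bahouri, J.-Y. Chemin, R. Danchin, *Fourier Analysis and Nonlinear PDE* (2011), §2.2.
-/

noncomputable section

open MeasureTheory Filter Topology FourierTransform Real Complex
open scoped SchwartzMap ENNReal NNReal ComplexConjugate RealInnerProductSpace FourierTransform

set_option linter.dupNamespace false

namespace Summit.NavierStokesRegularity.NavierStokesRegularity.Theorems.PerpetualPumpThesis.FA

open Literature.Analysis.FunctionSpaces Literature.Analysis.FluidPDE
  Literature.Analysis.FluidPDE.Tao2016

/-! ### The Leray symbol `P(η) e_i = e_i - (η_i/|η|²) η` -/

/-- `η · η = |η|²` for the complexified real vector. -/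
theorem cdot_complexify_self (η : EuclideanSpace ℝ (Fin 3)) :
    cdot (EuclideanSpace.complexify η) (EuclideanSpace.complexify η) = ((‖η‖ ^ 2 : ℝ) : ℂ) := by
  rw [EuclideanSpace.norm_sq_eq]
  simp only [cdot, EuclideanSpace.complexify_apply, Real.norm_eq_abs, sq_abs]
  push_cast
  refine Finset.sum_congr rfl fun j _ => by ring

/-- `η · e_i = η_i` and `e_i · v = v_i`. -/
theorem cdot_single_right (a : EuclideanSpace ℂ (Fin 3)) (i : Fin 3) :
    cdot a (EuclideanSpace.single i (1 : ℂ)) = a i := by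
  have := cdot_smul_single_right a 1 i
  rwa [one_smul, mul_one] at this

/-- `e_i · v = v_i`. -/
theorem cdot_single_left (a : EuclideanSpace ℂ (Fin 3)) (i : Fin 3) :
    cdot (EuclideanSpace.single i (1 : ℂ)) a = a i := by
  have := cdot_smul_single_left a 1 i
  rwa [one_smul, one_mul] at this

/-- **The Leray symbol is transverse**: `η · P(η)e_i = 0`. -/
theorem cdot_complexify_lerayVec (η : EuclideanSpace ℝ (Fin 3)) (i : Fin 3) :
    cdot (EuclideanSpace.complexify η) (EuclideanSpace.single i (1 : ℂ) -
      (EuclideanSpace.complexify η i / ((‖η‖ ^ 2 : ℝ) : ℂ)) • EuclideanSpace.complexify η) = 0 := by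
  rw [sub_eq_add_neg, cdot_add_right, cdot_neg_right, cdot_smul_right, cdot_single_right,
    cdot_complexify_self]
  by_cases h : η = 0
  · simp [h]
  · have hn : ((‖η‖ ^ 2 : ℝ) : ℂ) ≠ 0 := by exact_mod_cast (pow_pos (norm_pos_iff.2 h) 2).ne'
    field_simp
    ring

/-- **`P(η)e_i · v = v_i` for transverse `v`** (`η · v = 0`: the Leray projector is the identity on
divergence-free vectors). -/
theorem cdot_lerayVec_of_cdot_eq_zero (η : EuclideanSpace ℝ (Fin 3)) (i : Fin 3)
    {v : EuclideanSpace ℂ (Fin 3)} (hv : cdot (EuclideanSpace.complexify η) v = 0) :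
    cdot (EuclideanSpace.single i (1 : ℂ) -
      (EuclideanSpace.complexify η i / ((‖η‖ ^ 2 : ℝ) : ℂ)) • EuclideanSpace.complexify η) v = v i := by
  rw [sub_eq_add_neg, cdot_add_left, ← neg_smul, cdot_smul_left, hv, mul_zero, add_zero,
    cdot_single_left]

/-- The Leray symbol is real: `conj P(η)e_i = P(η)e_i`. -/
theorem conj3_lerayVec (η : EuclideanSpace ℝ (Fin 3)) (i : Fin 3) :
    conj3 (EuclideanSpace.single i (1 : ℂ) -
      (EuclideanSpace.complexify η i / ((‖η‖ ^ 2 : ℝ) : ℂ)) • EuclideanSpace.complexify η) =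
      EuclideanSpace.single i (1 : ℂ) -
        (EuclideanSpace.complexify η i / ((‖η‖ ^ 2 : ℝ) : ℂ)) • EuclideanSpace.complexify η := by
  rw [map_sub, conj3_smul, conj3_complexify]
  congr 1
  · ext j
    rw [conj3_apply, PiLp.single_apply]
    split_ifs <;> simp
  · rw [EuclideanSpace.complexify_apply, ← Complex.ofReal_div, Complex.conj_ofReal]

/-- The Leray symbol is even: `P(-η) = P(η)`. -/
theorem lerayVec_neg (η : EuclideanSpace ℝ (Fin 3)) (i : Fin 3) :
    EuclideanSpace.single i (1 : ℂ) -
      (EuclideanSpace.complexify (-η) i / ((‖-η‖ ^ 2 : ℝ) : ℂ)) • EuclideanSpace.complexify (-η) =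
      EuclideanSpace.single i (1 : ℂ) -
        (EuclideanSpace.complexify η i / ((‖η‖ ^ 2 : ℝ) : ℂ)) • EuclideanSpace.complexify η := by
  rw [map_neg, norm_neg, PiLp.neg_apply, neg_div, smul_neg, neg_smul, neg_neg]

/-- The Leray symbol is homogeneous of degree `0`: `P(cη) = P(η)` for `c ≠ 0`. -/
theorem lerayVec_smul {c : ℝ} (hc : c ≠ 0) (η : EuclideanSpace ℝ (Fin 3)) (i : Fin 3) :
    EuclideanSpace.single i (1 : ℂ) -
      (EuclideanSpace.complexify (c • η) i / ((‖c • η‖ ^ 2 : ℝ) : ℂ)) • EuclideanSpace.complexify (c • η) =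
      EuclideanSpace.single i (1 : ℂ) -
        (EuclideanSpace.complexify η i / ((‖η‖ ^ 2 : ℝ) : ℂ)) • EuclideanSpace.complexify η := by
  congr 1
  rw [LinearIsometry.map_smul, PiLp.smul_apply, norm_smul, mul_pow, Real.norm_eq_abs, sq_abs,
    ← Complex.coe_smul c (EuclideanSpace.complexify η), smul_smul]
  by_cases h : η = 0
  · simp [h]
  · congr 1
    have hn : ((‖η‖ ^ 2 : ℝ) : ℂ) ≠ 0 := by exact_mod_cast (pow_pos (norm_pos_iff.2 h) 2).ne'
    have hc' : (c : ℂ) ≠ 0 := by exact_mod_cast hc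
    rw [Complex.real_smul]
    push_cast
    field_simp

/-- `‖P(η)e_i‖ ≤ 2`. -/
theorem norm_lerayVec_le (η : EuclideanSpace ℝ (Fin 3)) (i : Fin 3) :
    ‖EuclideanSpace.single i (1 : ℂ) -
      (EuclideanSpace.complexify η i / ((‖η‖ ^ 2 : ℝ) : ℂ)) • EuclideanSpace.complexify η‖ ≤ 2 := by
  refine (norm_sub_le _ _).trans ?_
  rw [PiLp.norm_single, norm_one]
  suffices h : ‖(EuclideanSpace.complexify η i / ((‖η‖ ^ 2 : ℝ) : ℂ)) • EuclideanSpace.complexify η‖ ≤ 1 by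
    linarith
  by_cases h : η = 0
  · simp [h]
  · have hn : 0 < ‖η‖ := norm_pos_iff.2 h
    have hn' : ‖η‖ ≠ 0 := hn.ne'
    have hi : ‖η i‖ ≤ ‖η‖ := PiLp.norm_apply_le η i
    rw [norm_smul, norm_div, EuclideanSpace.norm_complexify, EuclideanSpace.complexify_apply,
      Complex.norm_real, Complex.norm_real, Real.norm_of_nonneg (sq_nonneg _)]
    calc ‖η i‖ / ‖η‖ ^ 2 * ‖η‖ = ‖η i‖ / ‖η‖ := by
          rw [div_mul_eq_mul_div, pow_two, mul_div_mul_right _ _ hn']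
      _ ≤ 1 := (div_le_one hn).2 hi

/-- The Leray symbol is a measurable function of `η` (continuous off the origin). -/
theorem measurable_lerayVec (i : Fin 3) :
    Measurable fun η : EuclideanSpace ℝ (Fin 3) => EuclideanSpace.single i (1 : ℂ) -
      (EuclideanSpace.complexify η i / ((‖η‖ ^ 2 : ℝ) : ℂ)) • EuclideanSpace.complexify η := by
  refine measurable_of_continuousOn_compl_singleton 0 ?_
  have h1 : ContinuousOn (fun η : EuclideanSpace ℝ (Fin 3) =>
      EuclideanSpace.complexify η i / ((‖η‖ ^ 2 : ℝ) : ℂ)) {0}ᶜ := by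
    refine ContinuousOn.div (Continuous.continuousOn ?_) (Continuous.continuousOn (by fun_prop))
      fun η hη => ?_
    · exact (EuclideanSpace.proj (𝕜 := ℂ) i).continuous.comp EuclideanSpace.continuous_complexify
    · have hη' : η ≠ 0 := hη
      exact Complex.ofReal_ne_zero.2 (pow_pos (norm_pos_iff.2 hη') 2).ne'
  have h2 : ContinuousOn (fun η : EuclideanSpace ℝ (Fin 3) =>
      (EuclideanSpace.complexify η i / ((‖η‖ ^ 2 : ℝ) : ℂ)) • EuclideanSpace.complexify η) {0}ᶜ :=
    h1.smul EuclideanSpace.continuous_complexify.continuousOn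
  have h3 : ContinuousOn (fun η : EuclideanSpace ℝ (Fin 3) => EuclideanSpace.single i (1 : ℂ) -
      (EuclideanSpace.complexify η i / ((‖η‖ ^ 2 : ℝ) : ℂ)) • EuclideanSpace.complexify η) {0}ᶜ :=
    continuousOn_const.sub h2
  exact h3

/-! ### The test fields -/

/-- The phase factor, conjugated: `conj e^{-2πi x·η} = e^{2πi x·η}`. -/
theorem conj_fourierChar_coe (t : ℝ) : conj (𝐞 t : ℂ) = (𝐞 (-t) : ℂ) := by
  rw [← Circle.coe_inv_eq_conj, AddChar.map_neg_eq_inv]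

/-- **The divergence-free test fields `w_{k,x,i} = P Δ̇_k δ_x e_i`**: for every `k ∈ ℤ`, `x ∈ ℝ³`,
`i ∈ {0,1,2}` there is `w ∈ H¹⁰_df(ℝ³)` (real, divergence free, `H¹⁰`) with
`ŵ(η) = e^{-2πi x·η} φ_k(η) P(η) e_i` a.e., such that for every divergence-free `f ∈ L²(ℝ³; ℂ³)`
`⟨f, w⟩ = (∫ e^{2πi x·ξ} φ_k(ξ) f̂(ξ) dξ)_i` — the `i`-th coordinate of the block `Δ̇_k f` at `x`. -/
theorem exists_testField (k : ℤ) (x : EuclideanSpace ℝ (Fin 3)) (i : Fin 3) :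
    ∃ w : L2C, MemH10df w ∧
      (fourierFn w =ᵐ[volume] fun η : EuclideanSpace ℝ (Fin 3) =>
        ((𝐞 (-⟪x, η⟫) : ℂ) * dyadicSymbol k η) •
          (EuclideanSpace.single i (1 : ℂ) -
            (EuclideanSpace.complexify η i / ((‖η‖ ^ 2 : ℝ) : ℂ)) • EuclideanSpace.complexify η)) ∧
      ∀ f : L2C, IsFourierDivFree f →
        pairing f w = 𝓕⁻ (fun ξ : EuclideanSpace ℝ (Fin 3) => dyadicSymbol k ξ • fourierFn f ξ) x i := by
  set L : EuclideanSpace ℝ (Fin 3) → EuclideanSpace ℂ (Fin 3) := fun η =>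
    EuclideanSpace.single i (1 : ℂ) -
      (EuclideanSpace.complexify η i / ((‖η‖ ^ 2 : ℝ) : ℂ)) • EuclideanSpace.complexify η with hL
  set s : EuclideanSpace ℝ (Fin 3) → ℂ := fun η => (𝐞 (-⟪x, η⟫) : ℂ) * dyadicSymbol k η with hs
  set Wf : EuclideanSpace ℝ (Fin 3) → EuclideanSpace ℂ (Fin 3) := fun η => s η • L η with hWf
  -- measurability, boundedness, compact support
  have hsc : Continuous s :=
    (continuous_subtype_val.comp (Real.continuous_fourierChar.comp
      (continuous_const.inner continuous_id).neg)).mul (contDiff_dyadicSymbol k).continuous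
  have hWm : AEStronglyMeasurable Wf volume :=
    (hsc.measurable.smul (measurable_lerayVec i)).aestronglyMeasurable
  have hWb : ∀ η, ‖Wf η‖ ≤ 2 * 2 := fun η => by
    rw [hWf]
    simp only
    rw [norm_smul]
    refine mul_le_mul ?_ (norm_lerayVec_le η i) (norm_nonneg _) zero_le_two
    rw [hs]
    simp only [norm_mul, Circle.norm_coe, one_mul]
    exact norm_dyadicSymbol_le_two k η
  have hWtop : MemLp Wf ∞ (volume : Measure (EuclideanSpace ℝ (Fin 3))) :=
    memLp_top_of_bound hWm (2 * 2) (ae_of_all _ hWb)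
  have hK : IsCompact (tsupport (dyadicSymbol (E := EuclideanSpace ℝ (Fin 3)) k)) :=
    hasCompactSupport_dyadicSymbol k
  have hsupp : ∀ η, η ∉ tsupport (dyadicSymbol (E := EuclideanSpace ℝ (Fin 3)) k) → Wf η = 0 := by
    intro η hη
    have h0 : dyadicSymbol k η = 0 := image_eq_zero_of_notMem_tsupport hη
    simp [hWf, hs, h0]
  have hW2 : MemLp Wf 2 (volume : Measure (EuclideanSpace ℝ (Fin 3))) :=
    hWtop.mono_exponent_of_measure_support_ne_top hsupp hK.measure_lt_top.ne le_top
  -- the field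
  set w : L2C := (𝓕⁻ (hW2.toLp Wf) : L2C) with hw
  have hFw : fourierFn w =ᵐ[volume] Wf := by
    unfold fourierFn
    rw [hw, fourier_fourierInv_eq]
    exact hW2.coeFn_toLp
  have hFw' : ∀ᵐ η : EuclideanSpace ℝ (Fin 3), fourierFn w (-η) = Wf (-η) :=
    (Measure.measurePreserving_neg (volume : Measure (EuclideanSpace ℝ (Fin 3)))).quasiMeasurePreserving.ae_eq hFw
  -- realness
  have hreal : IsReal w := by
    refine IsFourierHermitian.isReal ?_
    unfold IsFourierHermitian
    filter_upwards [hFw, hFw'] with η h1 h2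
    rw [h1, h2]
    simp only [hWf, hL, hs]
    rw [conj3_smul, conj3_lerayVec, lerayVec_neg, map_mul, conj_fourierChar_coe, conj_dyadicSymbol,
      inner_neg_right, neg_neg, dyadicSymbol_neg]
  -- divergence
  have hdiv : IsFourierDivFree w := by
    unfold IsFourierDivFree
    filter_upwards [hFw] with η h1
    rw [h1]
    simp only [hWf, hL, hs]
    rw [cdot_smul_right, cdot_complexify_lerayVec, mul_zero]
  -- band limitation and `H¹⁰`
  have hband : IsBandLimited (Metric.closedBall (0 : EuclideanSpace ℝ (Fin 3)) ((2 : ℝ) ^ (k + 1))) w := by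
    unfold IsBandLimited
    filter_upwards [hFw] with η h1 hη
    rw [h1]
    have hn : (2 : ℝ) ^ (k + 1) ≤ ‖η‖ := by
      rw [Metric.mem_closedBall, dist_zero_right, not_le] at hη
      exact hη.le
    simp [hWf, hs, dyadicSymbol_apply_of_le_norm_holds hn]
  refine ⟨w, hband.memH10df subset_rfl hreal hdiv, hFw, fun f hf => ?_⟩
  -- the pairing with a divergence-free field
  have hint : Integrable (fun ξ : EuclideanSpace ℝ (Fin 3) => dyadicSymbol k ξ • fourierFn f ξ) :=
    integrable_dyadicSymbol_smul_fourierFn k f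
  rw [fourierInv_apply_coord hint, pairing_eq_integral_cdot_fourierFn, Real.fourierInv_eq]
  refine integral_congr_ae ?_
  filter_upwards [hFw', hf] with ξ h1 h2
  rw [h1]
  simp only [hWf, hL, hs]
  rw [cdot_smul_left, lerayVec_neg, cdot_lerayVec_of_cdot_eq_zero ξ i h2, inner_neg_right, neg_neg,
    dyadicSymbol_neg, Circle.smul_def]
  simp only [PiLp.smul_apply, smul_eq_mul, real_inner_comm x ξ]
  ring

/-! ### The blocks of a divergence-free field through its pairings -/

/-- `‖v‖ ≤ ∑_i ‖v_i‖` on `ℂ³`, in `ℝ≥0∞`. -/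
theorem enorm_le_sum_enorm_apply (v : EuclideanSpace ℂ (Fin 3)) : ‖v‖ₑ ≤ ∑ i, ‖v i‖ₑ := by
  have hv : v = ∑ i, v i • EuclideanSpace.single i (1 : ℂ) := by
    simpa using ((EuclideanSpace.basisFun (Fin 3) ℂ).sum_repr v).symm
  have h : ‖v‖ ≤ ∑ i, ‖v i‖ := by
    conv_lhs => rw [hv]
    refine (norm_sum_le _ _).trans (Finset.sum_le_sum fun i _ => ?_)
    rw [norm_smul, PiLp.norm_single, norm_one, mul_one]
  calc ‖v‖ₑ = ENNReal.ofReal ‖v‖ := (ofReal_norm v).symm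
    _ ≤ ENNReal.ofReal (∑ i, ‖v i‖) := ENNReal.ofReal_le_ofReal h
    _ = ∑ i, ‖v i‖ₑ := by
        rw [ENNReal.ofReal_sum_of_nonneg fun i _ => norm_nonneg _]
        exact Finset.sum_congr rfl fun i _ => ofReal_norm _

/-- **The blocks of a divergence-free `L²` field are controlled by its pairings with the test
fields**: if `|⟨f, w⟩| ≤ B` for every `w ∈ H¹⁰_df` whose transform is `e^{-2πi x·η} φ_k(η) P(η) e_i`
(some `x ∈ ℝ³`, `i`), then `‖Δ̇_k f‖_{L^∞} ≤ 3B`. -/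
theorem eLpNormDistrib_lpBlock_coe_le_of_pairing (k : ℤ) (f : L2C) (hf : IsFourierDivFree f)
    {B : ℝ≥0∞}
    (hB : ∀ (x : EuclideanSpace ℝ (Fin 3)) (i : Fin 3) (w : L2C), MemH10df w →
      (fourierFn w =ᵐ[volume] fun η : EuclideanSpace ℝ (Fin 3) =>
        ((𝐞 (-⟪x, η⟫) : ℂ) * dyadicSymbol k η) •
          (EuclideanSpace.single i (1 : ℂ) -
            (EuclideanSpace.complexify η i / ((‖η‖ ^ 2 : ℝ) : ℂ)) • EuclideanSpace.complexify η)) →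
      ‖pairing f w‖ₑ ≤ B) :
    eLpNormDistrib ∞ (lpBlock k ((f : L2C) :
      𝓢'(EuclideanSpace ℝ (Fin 3), EuclideanSpace ℂ (Fin 3)))) ≤ 3 * B := by
  refine eLpNormDistrib_lpBlock_coe_le_of_forall k f fun x => ?_
  refine (enorm_le_sum_enorm_apply _).trans ?_
  calc ∑ i, ‖𝓕⁻ (fun ξ : EuclideanSpace ℝ (Fin 3) => dyadicSymbol k ξ • fourierFn f ξ) x i‖ₑ
      ≤ ∑ _i : Fin 3, B := Finset.sum_le_sum fun i _ => by
        obtain ⟨w, hw, hFw, hpair⟩ := exists_testField k x i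
        rw [← hpair f hf]
        exact hB x i w hw hFw
    _ = 3 * B := by
        rw [Finset.sum_const, Finset.card_univ, Fintype.card_fin, nsmul_eq_mul, Nat.cast_ofNat]

end Summit.NavierStokesRegularity.NavierStokesRegularity.Theorems.PerpetualPumpThesis.FA

namespace Summit.NavierStokesRegularity.NavierStokesRegularity.Theorems.PerpetualPumpThesis

open Literature.Analysis.FluidPDE Literature.Analysis.FluidPDE.Tao2016
open Literature.Analysis.FunctionSpaces

/-- **Part Test of stub `besovDuhamelBound` (registered sub-goal `stub_FA_Test`)**: the real,
divergence-free, band-limited test fields `w_{k,x,i} ∈ H¹⁰_df` with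
`ŵ(η) = e^{-2πi x·η} φ_k(η) P(η) e_i`, whose pairing with any divergence-free `f ∈ L²` is the `i`-th
coordinate of the block `Δ̇_k f` at `x` (the bridge from Tao's duality formulation to `Ḃ⁰_{∞,1}`). -/
theorem stub_FA_Test : ∀ (k : ℤ) (x : EuclideanSpace ℝ (Fin 3)) (i : Fin 3), ∃ w : L2C, MemH10df w ∧ (fourierFn w =ᵐ[volume] fun η : EuclideanSpace ℝ (Fin 3) => (((Real.fourierChar (-(inner ℝ x η)) : Circle) : ℂ) * dyadicSymbol k η) • (EuclideanSpace.single i (1 : ℂ) - (EuclideanSpace.complexify η i / ((‖η‖ ^ 2 : ℝ) : ℂ)) • EuclideanSpace.complexify η)) ∧ ∀ f : L2C, IsFourierDivFree f → pairing f w = FourierTransformInv.fourierInv (fun ξ : EuclideanSpace ℝ (Fin 3) => dyadicSymbol k ξ • fourierFn f ξ) x i :=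
  FA.exists_testField

end Summit.NavierStokesRegularity.NavierStokesRegularity.Theorems.PerpetualPumpThesis
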